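import Mathlib
import Summits.HodgeConjecture.HodgeConjecture.Theses.HeckePrymWeil
import Literature.AlgebraicGeometry.Motives.AbelianVarietyProduct
import Summits.HodgeConjecture.HodgeConjecture.Theorems.WeilTwelvefoldsSqrtMinus7.Negative.EigenvalueTyping

/-!
# Ideator-one sketch for crux `WeilTwelvefoldsSqrtMinus7` (stmt-HodgeConjecture-1261), round 1

First lemmas (elaborating, not proved unless trivial) of the three crux idea cards of ideator k = 1
(`isotypic-unimodular-saturation`, `amnesic-secant-sheaves-split-fourteenfolds`,
`polya-glued-box-products`), re-created by generation 2 of the seat (the generation-1 `Sketch.lean`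
is only on the evidence store).  Everything is stated over existing declarations:
`Literature.AlgebraicGeometry.Motives.AbelianVariety`, `.dim`, biproducts `⊞` from
`Motives/AbelianVarietyProduct`, `HodgeTheory.complexBetti(.map)`, `IsRationalClass`,
`IsOfHodgeType`, `algebraicClasses`, Mathlib `MvPolynomial.homogeneousSubmodule`, `TensorProduct`,
`Polynomial`.

It also records which landed Negative lemmas the sketches answer to
(`…Theorems.WeilTwelvefoldsSqrtMinus7.Negative.one_add_I_sqrt7_pow_ne`, `mixed_twelve`).
-/

noncomputable section

set_option linter.dupNamespace false

open CategoryTheory CategoryTheory.Limits Complex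
open Literature.AlgebraicGeometry Literature.AlgebraicGeometry.Motives
  Literature.AlgebraicGeometry.HodgeTheory
open Summit.HodgeConjecture.HodgeConjecture.Theses.HeckePrymWeil

namespace Summit.HodgeConjecture.HodgeConjecture.Cruxes.WeilTwelvefoldsSqrtMinus7.IdeatorOneSketch

/-! ## Shared typing: the rung predicate `HWA7 m` (Hodge–Weil classes Algebraic, `K = ℚ(√-7)`,
dimension `2m`) in the route's own single-operator eigenspace shape. -/

/-- `HWA7 m B ψ`: every rational `(m,m)`-class of `B` in the typed Weil plane of `(B, ψ)`
(`Eig((𝟙+ψ)^*, (1+i√7)^{2m}) ⊔ Eig((𝟙+ψ)^*, (1-i√7)^{2m})`) is algebraic. -/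
def HWA7 (m : ℕ) (B : AbelianVariety ℂ) (ψ : B ⟶ B) : Prop :=
  ∀ c : complexBetti B.X (2 * m), IsRationalClass c → IsOfHodgeType (2 * m) B.X (2 * m) m m c →
    c ∈ Module.End.eigenspace (complexBetti.map (CategoryStruct.id B + ψ).hom.hom.hom (2 * m)).hom
          ((1 + Complex.I * (Real.sqrt (7 : ℝ) : ℂ)) ^ (2 * m)) ⊔
        Module.End.eigenspace (complexBetti.map (CategoryStruct.id B + ψ).hom.hom.hom (2 * m)).hom
          ((1 - Complex.I * (Real.sqrt (7 : ℝ) : ℂ)) ^ (2 * m)) →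
    c ∈ algebraicClasses B.X m

/-- The crux is literally `∀ A φ, dim A = 12 → φ ≫ φ = -7 → HWA7 6 A φ`. -/
example : WeilTwelvefoldsSqrtMinus7 ↔
    ∀ (A : AbelianVariety ℂ) (φ : A ⟶ A), A.dim = 12 →
      CategoryStruct.comp φ φ = -((7 : ℤ) • CategoryStruct.id A) → HWA7 6 A φ :=
  Iff.rfl

/-- The two typed eigenvalues of the crux differ (landed Negative lemma, cdisprove cycle 1): the `⊔`
is a direct sum and `(𝟙+φ)^*` separates `w₊` from `w₋` — used by every line below when it splits a
rational Weil class and recombines. -/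
example : (1 + I * ((Real.sqrt (7 : ℝ) : ℝ) : ℂ)) ^ 12 ≠ (1 - I * ((Real.sqrt (7 : ℝ) : ℝ) : ℂ)) ^ 12 :=
  Summit.HodgeConjecture.HodgeConjecture.Theorems.WeilTwelvefoldsSqrtMinus7.Negative.weilEigenvalues_twelve_ne

/-- Same separation one Witt step up (`2m = 14`), needed by `HypSplitFourteenSuffices` below
(the `λ ≠ λ̄` step of the descent `A × E × E ↝ A`). -/
example : (1 + I * ((Real.sqrt (7 : ℝ) : ℝ) : ℂ)) ^ 14 ≠ (1 - I * ((Real.sqrt (7 : ℝ) : ℝ) : ℂ)) ^ 14 :=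
  Summit.HodgeConjecture.HodgeConjecture.Theorems.WeilTwelvefoldsSqrtMinus7.Negative.one_add_I_sqrt7_pow_ne
    14 (by norm_num)

/-! ## Card `isotypic-unimodular-saturation` (revised gen 2: NS by ONE norm pull-back) -/

/-- **Norm pull-back detects the isotypic line (linear-algebra shadow of the NS lemma).**
`V` = the irreducible 3-dimensional representation `χ` of `F₂₁` (complexified), `M` = its
multiplicity space in `H¹(C̃)`, `f` = the action on `χ` of the norm endomorphism `e = 1 + t + t²`
(`t` a generator of `μ₃`), `e₁` = the `ψ`-eigenvector of `N`; `f e₁ = v ≠ 0` (the `μ₃`-fixed vector).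
Then `m ↦ f(e₁) ⊗ m` is injective, so `e^*` maps the isotypic line `e₁ ⊗ M ⊂ H¹(B)` isomorphically
onto `v ⊗ M = q^* H¹(P)_σ`, and its 12th exterior power maps Schoen's algebraic line
`∧¹²(e₁ ⊗ M)` onto the pulled-back Weil line `v¹² ⊗ det M`.  Mathlib-level, provable now. -/
def NormPullbackInjective : Prop :=
  ∀ (V M : Type) [AddCommGroup V] [Module ℂ V] [AddCommGroup M] [Module ℂ M]
    (f : V →ₗ[ℂ] V) (e₁ : V), f e₁ ≠ 0 →
    Function.Injective ((TensorProduct.map f (LinearMap.id : M →ₗ[ℂ] M)) ∘ₗ (TensorProduct.mk ℂ V M e₁))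

/-- Proof of the shadow lemma: a functional `g` with `g (f e₁) = 1` splits `m ↦ f e₁ ⊗ m`. -/
theorem normPullbackInjective_holds : NormPullbackInjective := by
  intro V M _ _ _ _ f e₁ hf
  obtain ⟨g, hg⟩ := Module.Projective.exists_dual_eq_one ℂ hf
  intro m m' h
  have h' := congrArg (fun z => TensorProduct.lid ℂ M (TensorProduct.map g LinearMap.id z)) h
  simpa [hg] using h'

/-- **Unimodular saturation** (by-product lever, kept from gen 1): a subspace of degree-`k` forms in
3 variables stable under all unimodular integer substitutions is `0` or everything
(`SL₃(ℤ)` Zariski dense in `SL₃(ℂ)`, `Sym^k(ℂ³)` irreducible).  Gives ALL 91 lines of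
`E_χ = Sym¹²χ ⊗ det M_χ` algebraic on `B`, not only the Weil line. -/
def UnimodularSaturation : Prop :=
  ∀ (k : ℕ) (L : Submodule ℂ (MvPolynomial (Fin 3) ℂ)),
    L ≤ MvPolynomial.homogeneousSubmodule (Fin 3) ℂ k →
    (∀ M : Matrix (Fin 3) (Fin 3) ℤ, M.det = 1 →
      ∀ p ∈ L, MvPolynomial.aeval (fun i : Fin 3 => ∑ j : Fin 3, ((M i j : ℤ) : ℂ) • MvPolynomial.X j) p ∈ L) →
    L = ⊥ ∨ L = MvPolynomial.homogeneousSubmodule (Fin 3) ℂ k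

/-- The same in `m` variables (rungs `(p, g')`, `m = (p-1)/2`). -/
def UnimodularSaturationGeneral : Prop :=
  ∀ (m k : ℕ) (L : Submodule ℂ (MvPolynomial (Fin m) ℂ)),
    L ≤ MvPolynomial.homogeneousSubmodule (Fin m) ℂ k →
    (∀ M : Matrix (Fin m) (Fin m) ℤ, M.det = 1 →
      ∀ p ∈ L, MvPolynomial.aeval (fun i : Fin m => ∑ j : Fin m, ((M i j : ℤ) : ℂ) • MvPolynomial.X j) p ∈ L) →
    L = ⊥ ∨ L = MvPolynomial.homogeneousSubmodule (Fin m) ℂ k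

/-! ## Card `amnesic-secant-sheaves-split-fourteenfolds` -/

/-- `HypSplitFourteen`: Hodge–Weil classes are algebraic on every `A × E × E` with
`ψ = (φ, ι, -ι)`, `φ² = -7` on the 12-fold `A`, `ι² = -7` on the elliptic curve `E` — the split
(discriminant `-1`) 14-folds through which the disc `-1` component of 14-folds feeds EVERY
discriminant in dimension 12. -/
def HypSplitFourteen : Prop :=
  ∀ (A E : AbelianVariety ℂ) (φ : A ⟶ A) (ι : E ⟶ E), A.dim = 12 → E.dim = 1 →
    CategoryStruct.comp φ φ = -((7 : ℤ) • CategoryStruct.id A) →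
    CategoryStruct.comp ι ι = -((7 : ℤ) • CategoryStruct.id E) →
    HWA7 7 (A ⊞ (E ⊞ E)) (biprod.map φ (biprod.map ι (-ι)))

/-- The reduction the line proves first (Künneth + Gysin, as `WeilDescending` item 1263 with the
refuters' repair `E' = E`): `HypSplitFourteen → crux`. -/
def HypSplitFourteenSuffices : Prop :=
  HypSplitFourteen → WeilTwelvefoldsSqrtMinus7

/-- Markman's theorem one Witt step up, typed: disc `-1` fourteenfolds of `K = ℚ(√-7)` contain the
split ones, so `HWA7 7` on them implies `HypSplitFourteen` (the card's `C⁺`; informal component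
condition replaced by the split models themselves). -/
example : (∀ (B : AbelianVariety ℂ) (ψ : B ⟶ B), B.dim = 14 →
      CategoryStruct.comp ψ ψ = -((7 : ℤ) • CategoryStruct.id B) → HWA7 7 B ψ) →
    HypSplitFourteen := by
  intro h A E φ ι hA hE hφ hι
  refine h (A ⊞ (E ⊞ E)) _ ?_ ?_
  · -- dim (A ⊞ (E ⊞ E)) = 12 + (1 + 1) = 14: `dim_prod` transported along `biprodIsoProd`
    -- (dimension is an isomorphism invariant) — bookkeeping stub
    sorry
  · -- (φ ⊞ (ι ⊞ -ι))² = φ² ⊞ (ι² ⊞ ι²) = -7 (biprod.map is functorial, (-ι) ≫ (-ι) = ι ≫ ι in a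
    -- preadditive category) — bookkeeping stub
    sorry

/-! ## Card `polya-glued-box-products` -/

/-- **Pólya positive multiplier** (Poincaré 1883 / Pólya 1928), the arithmetic engine of move (Π):
a real polynomial positive on `[0, ∞)` becomes coefficientwise non-negative after multiplication by a
power of `1 + X`.  Not in Mathlib; first stub of the line. -/
def PolyaPositiveMultiplier : Prop :=
  ∀ q : Polynomial ℝ, (∀ x : ℝ, 0 ≤ x → 0 < q.eval x) →
    ∃ N : ℕ, ∀ i : ℕ, 0 ≤ (((1 : Polynomial ℝ) + Polynomial.X) ^ N * q).coeff i

/-- The instance used: the bad character values `μ_ε = σ(k)^{4a} σ̄(k)^{4b}` (`a ≠ b`,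
`k = 1 + √-7`) are non-real, so `q_ε(x) = (x - μ_ε)(x - μ̄_ε) > 0` on `ℝ`; non-reality is exactly the
landed eigenvalue separation `one_add_I_sqrt7_pow_ne (4|a-b|)`. -/
example (a b : ℕ) (hab : a ≠ b) :
    (1 + I * ((Real.sqrt (7 : ℝ) : ℝ) : ℂ)) ^ (4 * (max a b - min a b)) ≠
      (1 - I * ((Real.sqrt (7 : ℝ) : ℝ) : ℂ)) ^ (4 * (max a b - min a b)) :=
  Summit.HodgeConjecture.HodgeConjecture.Theorems.WeilTwelvefoldsSqrtMinus7.Negative.one_add_I_sqrt7_pow_ne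
    _ (by omega)

end Summit.HodgeConjecture.HodgeConjecture.Cruxes.WeilTwelvefoldsSqrtMinus7.IdeatorOneSketch

end
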